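import Literature.Computability.Complexity.MatchingSunflowersProofs
import Summits.PneNP.PneNP.Theorems.NegLimitedBiasedMeasureFlip

/-!
# Route NegLimited — R7-B: the Matching Sunflower Lemma for the biased cross-cut measure (rung F-N1/p3, ROUND-7)

The Matching Sunflower Lemma of Cavalar–Göös–Riazanov–Sofronova–Sokolov (CGRSS, arXiv:2507.16105,
Lemma 2; proved in the tree for the printed odd-cut distribution, `MatchingSunflowersProofs.lean`)
for the **`p`-biased cross-cut measure**: a random vertex set `W ⊆ U ⊔ V` of `K_{m,m}`, each
vertex independently with probability `p ≤ 1/2` (`Literature.Combinatorics.SetFamily.biasedWeight`),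
and the negative test graph `crossGraph W` = the edges with exactly one endpoint in `W` (matching
number `≤ |W|`, so far from a perfect matching at small `p`, which odd-cut graphs are not). NOT
IN PRINT as stated (hence under `Summits/`): it is R7-B of the cell pnp-ideate (rung F-N1/p3,
HOME/pnp-ideate-p3/ROUND-7.md §2, Sketch-R7.lean `P3R7.BiasedMatchingSunflower` token-for-token),
the one new lemma of the work-bound rung towards T5⁺ `GapPerfectMatchingExp` and item
stmt-PneNP-19861; this file discharges the registered stub `stub_biasedMatchingSunflower` of the
skeleton line `r7-crosscut` (HOME/pnp-ideate-p3/Skeleton-R7-crosscut.lean, sha 0079776e761d5a21)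
in the shared namespace `Summit.PneNP.PneNP.Theorems.NegLimitedGapPM` (definitions verbatim from
HOME/pnp-ideate-p3/turnkey-R8/NegLimitedGapPMDefs.lean).

* `crossGraph W` (input form `crossInput W`), `IsCrossMatchingSunflower p ε 𝓕` —
  `|𝓕| ≥ 2 ∧ Pr_{W ∼ μ_p}[∃ M ∈ 𝓕, M ∖ ⋂𝓕 ⊆ crossGraph W] > 1 - ε`;
* `BiasedMatchingSunflower` — a universal `c₀ > 0` such that for `ℓ ≥ 1`, `0 < p ≤ 1/2`,
  `0 < ε ≤ 1/2`, every family of `ℓ`-matchings with `≥ (c₀ ℓ log²(ℓ/ε) / p²)^ℓ` members contains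
  such a sunflower; `biasedMatchingSunflower_holds` — its proof (`c₀ = 12 B²`, `B = 2000`);
  `stub_biasedMatchingSunflower` — the same, under the registered stub name.

**Proof.** CGRSS §2 verbatim up to Claim 1, at bias `p`: a labelling consistent with many
members (`PerfectMatching.exists_labelling`), blocky members determined by their endpoint sets
(`PerfectMatching.Consistent.eq_of_everts_eq`), the robust sunflower theorem
(`Literature.Combinatorics.SetFamily.robust_sunflower_spreadConst`) at `(p, ε)` for the
`2ℓ`-uniform vertex family. Claim 1 is replaced by TARGETS (`crossTarget`): given the trace of
`W` on the solo core vertices `K₁`, every non-core vertex has a target side — opposite to its solo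
core partner if its label has one, else "in" for left and "out" for right vertices — such that a
member all of whose non-core endpoints are on target is a cross member (`cross_of_crossTarget`,
the three cases of CGRSS Claim 1 via `mem_core_of_endpoints` / `eq_endpoint_of_label`); and the
probability that some member of the vertex sunflower has all its non-core vertices on target is
at least its robustness `> 1 - ε`, by the conditional flip coupling
`BiasedFlip.sum_biasedWeight_filter_le_symmDiff` of `NegLimitedBiasedMeasureFlip.lean` (reveal the
core, flip the non-core vertices whose target is "out"; uses `p ≤ 1/2`). No parity conditioning,
so `ε` is not halved. References: CGRSS, STOC 2026 / arXiv:2507.16105 §2 [CavalarEtAl2026];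
Cavalar–Kumar–Rossman, Algorithmica 84 (2022) Thm. 1.3 [CavalarKumarRossman2022].
-/

set_option linter.dupNamespace false -- `Summit.PneNP.PneNP.…`: summit = sub-problem name (D-0017 single-conjunct layout)

namespace Summit.PneNP.PneNP.Theorems.NegLimitedGapPM

open Finset Literature.Combinatorics Literature.Computability.Complexity
  Literature.Computability.Complexity.PerfectMatching
open Literature.Combinatorics.SetFamily (biasedWeight)

variable {m : ℕ}

/-! ### The cross-cut graph and cross matching sunflowers -/

/-- The **cross-cut graph** of a vertex set `W ⊆ U ⊔ V`: the edges of `K_{m,m}` with exactly one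
endpoint in `W` (the union of the two bicliques `(U ∩ W) × (V ∖ W)` and `(U ∖ W) × (V ∩ W)`; its
matching number is at most `|W|`); cf. the cut graphs `colorGraph` of CGRSS Def. 1 (arXiv:2507.16105
§1.1), with the right side complemented. -/
def crossGraph (W : Finset (Vtx m)) : Finset (Edge m) :=
  univ.filter fun e => ¬ ((Sum.inl e.1 ∈ W) ↔ (Sum.inr e.2 ∈ W))

/-- Membership in the cross-cut graph. [folklore] -/
@[simp] theorem mem_crossGraph {W : Finset (Vtx m)} {e : Edge m} :
    e ∈ crossGraph W ↔ ¬ ((Sum.inl e.1 ∈ W) ↔ (Sum.inr e.2 ∈ W)) := by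
  simp [crossGraph]

/-- The cross-cut graph as an input `K_{m,m} → {0,1}`. -/
def crossInput (W : Finset (Vtx m)) : Edge m → Bool := fun e => decide (e ∈ crossGraph W)

/-- An **`ε`-matching sunflower for the `p`-biased cross-cut measure**: a family `𝓕` with
`|𝓕| ≥ 2` and `Pr_{W ∼ μ_p}[∃ M ∈ 𝓕, M ∖ ⋂𝓕 ⊆ crossGraph W] > 1 - ε` — CGRSS's `ε`-matching
sunflower with the odd-cut distribution replaced by the `p`-biased product measure on the `2m`
vertices and cut graphs by cross-cut graphs (cf. CGRSS arXiv:2507.16105 §1.1, display before Lemma 2). -/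
def IsCrossMatchingSunflower (p ε : ℝ) (𝓕 : Finset (Finset (Edge m))) : Prop :=
  2 ≤ #𝓕 ∧
    1 - ε < ∑ W ∈ univ.filter (fun W : Finset (Vtx m) => ∃ M ∈ 𝓕, M \ core 𝓕 ⊆ crossGraph W),
      biasedWeight p W

/-- A cross matching sunflower has at least two members. [folklore] -/
theorem IsCrossMatchingSunflower.two_le_card {p ε : ℝ} {𝓕 : Finset (Finset (Edge m))}
    (h : IsCrossMatchingSunflower p ε 𝓕) : 2 ≤ #𝓕 := h.1

/-- The cross sunflower condition is monotone in the error parameter. [folklore] -/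
theorem IsCrossMatchingSunflower.mono {p ε ε' : ℝ} {𝓕 : Finset (Finset (Edge m))}
    (h : IsCrossMatchingSunflower p ε 𝓕) (hε : ε ≤ ε') : IsCrossMatchingSunflower p ε' 𝓕 :=
  ⟨h.1, lt_of_le_of_lt (by linarith) h.2⟩

/-! ### The biased Claim 1: targets instead of the recolouring involution -/

section BiasedClaim

variable {ℓ : ℕ} {b : Vtx m → Fin ℓ} {𝓕' : Finset (Finset (Edge m))}
  (h𝓕' : ∀ M ∈ 𝓕', IsMatching M ∧ Consistent b M)

variable (b 𝓕') in
/-- The **target** of a vertex `v` given the set `W` (through its trace on the solo core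
vertices `K₁ = soloCore`): if some solo core vertex `w` carries the label of `v`, the target of
`v` is the side of the cut opposite to `w` (`true` = "in `W`" iff `w ∉ W`); otherwise left
vertices have target "in `W`" and right vertices "not in `W`". (Replaces the recolouring
pattern `x^α` of CGRSS §2, proof of Claim 1, for the cross-cut measure.) -/
def crossTarget (W : Finset (Vtx m)) (v : Vtx m) : Bool :=
  if (∃ w ∈ soloCore b 𝓕', b w = b v) then decide (∃ w ∈ soloCore b 𝓕', b w = b v ∧ w ∉ W)
  else v.isLeft

/-- Next to a solo core vertex `v'` the target is the side opposite to `v'`. [folklore] -/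
private theorem crossTarget_eq_not {W : Finset (Vtx m)} {v v' : Vtx m} (hv' : v' ∈ soloCore b 𝓕')
    (h : b v = b v') : crossTarget b 𝓕' W v = !decide (v' ∈ W) := by
  unfold crossTarget
  have hex : ∃ w ∈ soloCore b 𝓕', b w = b v := ⟨v', hv', h.symm⟩
  rw [if_pos hex]
  have huniq : ∀ w ∈ soloCore b 𝓕', b w = b v → w = v' := by
    intro w hw hbw
    exact (mem_filter.1 hv').2 w (mem_filter.1 hw).1 (hbw.trans h)
  by_cases hW : v' ∈ W
  · simp only [hW, decide_true, Bool.not_true, decide_eq_false_iff_not, not_exists, not_and,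
      not_not]
    intro w hw hbw
    rw [huniq w hw hbw]; exact hW
  · simp only [hW, decide_false, Bool.not_false, decide_eq_true_eq]
    exact ⟨v', hv', h.symm, hW⟩

/-- With no solo core vertex of its label, the target of a vertex is its side. [folklore] -/
private theorem crossTarget_eq_isLeft {W : Finset (Vtx m)} {v : Vtx m}
    (h : ¬ ∃ w ∈ soloCore b 𝓕', b w = b v) : crossTarget b 𝓕' W v = v.isLeft := by
  unfold crossTarget; rw [if_neg h]

/-- The targets depend on `W` only through its trace on any set containing the solo core
vertices. [folklore] -/
theorem crossTarget_inter {W K : Finset (Vtx m)} (hK : soloCore b 𝓕' ⊆ K) (v : Vtx m) :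
    crossTarget b 𝓕' (W ∩ K) v = crossTarget b 𝓕' W v := by
  unfold crossTarget
  split_ifs with h
  · have hiff : (∃ w ∈ soloCore b 𝓕', b w = b v ∧ w ∉ W ∩ K) ↔
        (∃ w ∈ soloCore b 𝓕', b w = b v ∧ w ∉ W) := by
      refine exists_congr fun w => ?_
      constructor
      · rintro ⟨hw, hb, hn⟩
        exact ⟨hw, hb, fun hW => hn (mem_inter.2 ⟨hW, hK hw⟩)⟩
      · rintro ⟨hw, hb, hn⟩
        exact ⟨hw, hb, fun hW => hn (mem_inter.1 hW).1⟩
    by_cases hq : ∃ w ∈ soloCore b 𝓕', b w = b v ∧ w ∉ W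
    · rw [decide_eq_true hq, decide_eq_true (hiff.2 hq)]
    · rw [decide_eq_false hq, decide_eq_false (fun h' => hq (hiff.1 h'))]
  · rfl

include h𝓕' in
/-- **Biased Claim 1, pointwise**: if every non-core endpoint of some member `M` of a blocky
family hits its target, then every edge of `M` outside the edge core is a cross edge of `W`
(the three cases of CGRSS Claim 1: an edge with both endpoints in the vertex core lies in the
edge core; a core endpoint of an edge outside the edge core is solo and its partner's target is
the opposite side; an edge with no core endpoint has no core vertex of its label, so its left
endpoint targets "in" and its right endpoint "out"). [cite: CavalarEtAl2026, §2, Claim 1, variant] -/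
theorem cross_of_crossTarget {W : Finset (Vtx m)} {M : Finset (Edge m)} (hM : M ∈ 𝓕')
    (hhit : ∀ v ∈ everts M, v ∉ SetFamily.core (𝓕'.image everts) →
      decide (v ∈ W) = crossTarget b 𝓕' W v) :
    M \ core 𝓕' ⊆ crossGraph W := by
  set K := SetFamily.core (𝓕'.image everts) with hK
  intro e he
  rw [mem_crossGraph]
  obtain ⟨heM, heD⟩ := mem_sdiff.1 he
  have hmono : b (Sum.inl e.1) = b (Sum.inr e.2) := (h𝓕' M hM).2.1 e heM
  have huM : (Sum.inl e.1 : Vtx m) ∈ everts M := inl_mem_everts.2 ⟨e, heM, rfl⟩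
  have hvM : (Sum.inr e.2 : Vtx m) ∈ everts M := inr_mem_everts.2 ⟨e, heM, rfl⟩
  -- a core endpoint of `e ∉ D` whose partner is outside the core is solo
  have hsolo : ∀ {w w₂ : Vtx m},
      (w = Sum.inl e.1 ∧ w₂ = Sum.inr e.2) ∨ (w = Sum.inr e.2 ∧ w₂ = Sum.inl e.1) →
      w ∈ K → w₂ ∉ K → w ∈ soloCore b 𝓕' := by
    rintro w w₂ hww hw hw₂
    refine mem_filter.2 ⟨hw, fun w' hw' hbw' => ?_⟩
    have hbw'e : b w' = b (Sum.inl e.1) := by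
      rcases hww with ⟨rfl, rfl⟩ | ⟨rfl, rfl⟩
      · exact hbw'
      · rw [hbw', hmono]
    rcases eq_endpoint_of_label h𝓕' hM heM hw' hbw'e with h | h
    · rcases hww with ⟨rfl, rfl⟩ | ⟨rfl, rfl⟩
      · exact h
      · exact absurd (h ▸ hw') hw₂
    · rcases hww with ⟨rfl, rfl⟩ | ⟨rfl, rfl⟩
      · exact absurd (h ▸ hw') hw₂
      · exact h
  by_cases hu : (Sum.inl e.1 : Vtx m) ∈ K <;> by_cases hv : (Sum.inr e.2 : Vtx m) ∈ K
  · exact absurd (mem_core_of_endpoints h𝓕' hM heM hu hv) heD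
  · -- `u ∈ K` solo, `v ∉ K`: the target of `v` is the side opposite to `u`
    have hus : (Sum.inl e.1 : Vtx m) ∈ soloCore b 𝓕' := hsolo (Or.inl ⟨rfl, rfl⟩) hu hv
    have h1 := hhit _ hvM hv
    rw [crossTarget_eq_not hus hmono.symm] at h1
    revert h1
    by_cases ha : (Sum.inl e.1 : Vtx m) ∈ W <;> by_cases hb : (Sum.inr e.2 : Vtx m) ∈ W <;>
      simp [ha, hb]
  · -- `v ∈ K` solo, `u ∉ K`
    have hvs : (Sum.inr e.2 : Vtx m) ∈ soloCore b 𝓕' := hsolo (Or.inr ⟨rfl, rfl⟩) hv hu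
    have h1 := hhit _ huM hu
    rw [crossTarget_eq_not hvs hmono] at h1
    revert h1
    by_cases ha : (Sum.inl e.1 : Vtx m) ∈ W <;> by_cases hb : (Sum.inr e.2 : Vtx m) ∈ W <;>
      simp [ha, hb]
  · -- both endpoints outside the core: no (solo) core vertex carries the label of `e`
    have hno : ¬ ∃ w ∈ soloCore b 𝓕', b w = b (Sum.inl e.1) := by
      rintro ⟨w, hw, hbw⟩
      rcases eq_endpoint_of_label h𝓕' hM heM (mem_filter.1 hw).1 hbw with h | h
      · exact hu (h ▸ (mem_filter.1 hw).1)
      · exact hv (h ▸ (mem_filter.1 hw).1)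
    have hno' : ¬ ∃ w ∈ soloCore b 𝓕', b w = b (Sum.inr e.2) := by rwa [← hmono]
    have h1 := hhit _ huM hu
    have h2 := hhit _ hvM hv
    rw [crossTarget_eq_isLeft hno] at h1
    rw [crossTarget_eq_isLeft hno'] at h2
    revert h1 h2
    by_cases ha : (Sum.inl e.1 : Vtx m) ∈ W <;> by_cases hb : (Sum.inr e.2 : Vtx m) ∈ W <;>
      simp [ha, hb]

end BiasedClaim

/-! ### Assembly -/

/-- **The Matching Sunflower Lemma for the `p`-biased cross-cut measure** (R7-B of the cell
pnp-ideate, rung F-N1/p3; NOT in print as stated — the `p`-biased cross-cut variant of CGRSS,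
arXiv:2507.16105, Lemma 2; PROVED below, `biasedMatchingSunflower_holds`): there is a universal
`c₀ > 0` such that for `ℓ ≥ 1`, `0 < p ≤ 1/2`, `0 < ε ≤ 1/2`, every family of `ℓ`-matchings of
`K_{m,m}` with at least `(c₀ ℓ log²(ℓ/ε) / p²)^ℓ` members contains an `ε`-matching sunflower for
the `p`-biased cross-cut measure. -/
def BiasedMatchingSunflower : Prop :=
  ∃ c₀ : ℝ, 0 < c₀ ∧ ∀ (m ℓ : ℕ) (p ε : ℝ), 1 ≤ ℓ → 0 < p → p ≤ 1 / 2 → 0 < ε → ε ≤ 1 / 2 →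
    ∀ 𝓕 : Finset (Finset (Edge m)), (∀ M ∈ 𝓕, IsMatching M ∧ #M = ℓ) →
      (c₀ * ℓ * Real.log (ℓ / ε) ^ 2 / p ^ 2) ^ ℓ ≤ (#𝓕 : ℝ) →
        ∃ 𝓕' ⊆ 𝓕, IsCrossMatchingSunflower (m := m) p ε 𝓕'

/-- **R7-B proved**, with `c₀ = 12 · B²`, `B = 2000` the spread-lemma constant. Proof: CGRSS §2
up to Claim 1 verbatim at bias `p` — a labelling `b` consistent with `≥ |𝓕| ℓ!/ℓ^{2ℓ}` members
(`exists_labelling`), the blocky members are determined by their `2ℓ`-sets of endpoints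
(`Consistent.eq_of_everts_eq`), the robust sunflower theorem
(`Literature.Combinatorics.SetFamily.robust_sunflower_spreadConst`) at `(p, ε)` for the vertex
family (threshold `(B log(2ℓ/ε)/p)^{2ℓ} ≤ (12 B² ℓ log²(ℓ/ε)/p²)^ℓ · ℓ!/ℓ^{2ℓ}` by
`log(2ℓ/ε) ≤ 2 log(ℓ/ε)` and `ℓ^ℓ ≤ 3^ℓ ℓ!`); then, instead of the uniform recolouring involution,
the conditional flip coupling `BiasedFlip.sum_biasedWeight_filter_le_symmDiff`
(revealed coordinates = the vertex core `K`, flipped coordinates = the non-core vertices whose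
target is "out of `W`", event = the robustness event `∃ V ∈ 𝒱', V ∖ K ⊆ W`, up-closed) shows that
with `μ_p`-probability `> 1 - ε` some member has all its non-core endpoints on target, and the
pointwise biased Claim 1 (`cross_of_crossTarget`) makes that member a cross member.
[cite: CavalarEtAl2026, Lemma 2 (§1.1; proof §2, Claim 1), variant] [cite: CavalarKumarRossman2022, Thm. 1.3] -/
theorem biasedMatchingSunflower_holds : BiasedMatchingSunflower := by
  refine ⟨12 * SetFamily.spreadConst ^ 2, by have := SetFamily.spreadConst_pos; positivity, ?_⟩
  intro m ℓ p ε hℓ hp0 hp1 hε0 hε1 𝓕 h𝓕 hbig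
  set B : ℝ := SetFamily.spreadConst with hB
  have hBpos : 0 < B := SetFamily.spreadConst_pos
  set L : ℝ := Real.log (ℓ / ε) with hL
  -- positivity of the logarithm
  have hℓr : (1 : ℝ) ≤ ℓ := by exact_mod_cast hℓ
  have hx2 : (2 : ℝ) ≤ ℓ / ε := by rw [le_div_iff₀ hε0]; linarith
  have hL2 : Real.log 2 ≤ L := Real.log_le_log two_pos hx2
  have hLpos : 0 < L := lt_of_lt_of_le (Real.log_pos one_lt_two) hL2
  -- Step 1: a good labelling and the blocky family
  obtain ⟨b, hb⟩ := exists_labelling 𝓕 hℓ h𝓕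
  set 𝓕b := 𝓕.filter fun M => Consistent b M with h𝓕b
  have h𝓕b : ∀ M ∈ 𝓕b, IsMatching M ∧ Consistent b M := fun M hM =>
    ⟨(h𝓕 M (mem_filter.1 hM).1).1, (mem_filter.1 hM).2⟩
  -- Step 2: the vertex family
  set 𝒱 := 𝓕b.image everts with h𝒱
  have hinj : Set.InjOn everts (𝓕b : Set (Finset (Edge m))) := fun M hM M' hM' h =>
    (h𝓕b M hM).2.eq_of_everts_eq (h𝓕b M' hM').2 h
  have h𝒱card : #𝒱 = #𝓕b := card_image_of_injOn hinj
  have h𝒱unif : ∀ V ∈ 𝒱, #V = 2 * ℓ := by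
    intro V hV
    obtain ⟨M, hM, rfl⟩ := mem_image.1 hV
    have hMm : IsMatching M := (h𝓕b M hM).1
    -- a matching with `ℓ` edges covers `2ℓ` vertices
    unfold everts
    rw [card_union_of_disjoint, card_image_of_injOn, card_image_of_injOn,
      (h𝓕 M (mem_filter.1 hM).1).2, two_mul]
    · intro e₁ h₁ e₂ h₂ h
      exact hMm.2 e₁ h₁ e₂ h₂ (Sum.inr_injective h)
    · intro e₁ h₁ e₂ h₂ h
      exact hMm.1 e₁ h₁ e₂ h₂ (Sum.inl_injective h)
    · rw [disjoint_left]
      intro v hv hv'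
      obtain ⟨e, -, rfl⟩ := mem_image.1 hv
      obtain ⟨e', -, h⟩ := mem_image.1 hv'
      exact Sum.inr_ne_inl h
  -- Step 3: the size of `𝒱` beats the robust-sunflower threshold at `(p, ε)`
  have hsize : (B * Real.log (((2 * ℓ : ℕ) : ℝ) / ε) / p) ^ (2 * ℓ) ≤ (#𝒱 : ℝ) := by
    have hlog : Real.log (((2 * ℓ : ℕ) : ℝ) / ε) = Real.log 2 + L := by
      have : ((2 * ℓ : ℕ) : ℝ) / ε = 2 * (ℓ / ε) := by push_cast; ring
      rw [this, Real.log_mul (by norm_num) (by positivity)]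
    have hlogle : Real.log (((2 * ℓ : ℕ) : ℝ) / ε) ≤ 2 * L := by rw [hlog]; linarith
    have hlog0 : 0 ≤ Real.log (((2 * ℓ : ℕ) : ℝ) / ε) := by rw [hlog]; positivity
    -- threshold ≤ (2BL/p)^{2ℓ} = (4 B² L²/p²)^ℓ
    have hT : (B * Real.log (((2 * ℓ : ℕ) : ℝ) / ε) / p) ^ (2 * ℓ) ≤
        (4 * B ^ 2 * L ^ 2 / p ^ 2) ^ ℓ := by
      have h6 : B * Real.log (((2 * ℓ : ℕ) : ℝ) / ε) / p ≤ 2 * B * L / p := by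
        rw [div_le_div_iff_of_pos_right hp0]
        nlinarith
      calc (B * Real.log (((2 * ℓ : ℕ) : ℝ) / ε) / p) ^ (2 * ℓ)
          ≤ (2 * B * L / p) ^ (2 * ℓ) := pow_le_pow_left₀ (by positivity) h6 _
        _ = (4 * B ^ 2 * L ^ 2 / p ^ 2) ^ ℓ := by rw [pow_mul]; congr 1; field_simp; ring
    -- the blocky family is large: #𝓕b ℓ^{2ℓ} ≥ #𝓕 ℓ! ≥ (c₀ ℓ L²/p²)^ℓ ℓ!
    have hbR : (#𝓕 : ℝ) * ℓ.factorial ≤ #𝓕b * (ℓ : ℝ) ^ (2 * ℓ) := by exact_mod_cast hb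
    -- `ℓ^ℓ ≤ 3^ℓ · ℓ!`, from `ℓ^ℓ/ℓ! ≤ e^ℓ ≤ 3^ℓ`
    have hfac : ((ℓ : ℝ)) ^ ℓ ≤ (3 : ℝ) ^ ℓ * ℓ.factorial := by
      have h1 := Real.pow_div_factorial_le_exp (ℓ : ℝ) (show (0 : ℝ) ≤ (ℓ : ℝ) by positivity) ℓ
      have hfp : (0 : ℝ) < ℓ.factorial := by exact_mod_cast Nat.factorial_pos ℓ
      rw [div_le_iff₀ hfp] at h1
      have h2 : Real.exp ℓ ≤ (3 : ℝ) ^ ℓ := by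
        rw [show (ℓ : ℝ) = ℓ * 1 by ring, Real.exp_nat_mul]
        exact pow_le_pow_left₀ (Real.exp_pos 1).le (by have := Real.exp_one_lt_d9; linarith) ℓ
      exact h1.trans (mul_le_mul_of_nonneg_right h2 hfp.le)
    have hℓpow : (0 : ℝ) < (ℓ : ℝ) ^ (2 * ℓ) := by positivity
    have hp2 : (0 : ℝ) < p ^ 2 := by positivity
    rw [h𝒱card]
    refine le_of_mul_le_mul_right ?_ hℓpow
    calc (B * Real.log (((2 * ℓ : ℕ) : ℝ) / ε) / p) ^ (2 * ℓ) * (ℓ : ℝ) ^ (2 * ℓ)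
        ≤ (4 * B ^ 2 * L ^ 2 / p ^ 2) ^ ℓ * (ℓ : ℝ) ^ (2 * ℓ) :=
          mul_le_mul_of_nonneg_right hT hℓpow.le
      _ = (4 * B ^ 2 * L ^ 2 / p ^ 2 * ℓ) ^ ℓ * (ℓ : ℝ) ^ ℓ := by
          rw [pow_mul, ← mul_pow, ← mul_pow]; ring
      _ ≤ (4 * B ^ 2 * L ^ 2 / p ^ 2 * ℓ) ^ ℓ * ((3 : ℝ) ^ ℓ * ℓ.factorial) :=
          mul_le_mul_of_nonneg_left hfac (by positivity)
      _ = (12 * B ^ 2 * ℓ * L ^ 2 / p ^ 2) ^ ℓ * ℓ.factorial := by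
          rw [← mul_assoc, ← mul_pow]; congr 2; field_simp; ring
      _ ≤ #𝓕 * ℓ.factorial := mul_le_mul_of_nonneg_right hbig (by positivity)
      _ ≤ #𝓕b * (ℓ : ℝ) ^ (2 * ℓ) := hbR
  -- Step 4: the vertex sunflower and the corresponding matchings
  obtain ⟨𝒱', h𝒱'sub, h𝒱'two, hrob⟩ := SetFamily.robust_sunflower_spreadConst 𝒱 (2 * ℓ) p ε
    (by omega) hp0 hp1 hε0 hε1 h𝒱unif hsize
  set 𝓕' := 𝓕b.filter fun M => everts M ∈ 𝒱' with h𝓕'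
  have h𝓕'b : ∀ M ∈ 𝓕', IsMatching M ∧ Consistent b M := fun M hM => h𝓕b M (mem_filter.1 hM).1
  have himg : 𝓕'.image everts = 𝒱' := by
    ext V
    constructor
    · intro hV
      obtain ⟨M, hM, rfl⟩ := mem_image.1 hV
      exact (mem_filter.1 hM).2
    · intro hV
      obtain ⟨M, hM, rfl⟩ := mem_image.1 (h𝒱'sub hV)
      exact mem_image.2 ⟨M, mem_filter.2 ⟨hM, hV⟩, rfl⟩
  have h𝓕'card : #𝓕' = #𝒱' := by
    rw [← himg, card_image_of_injOn fun M hM M' hM' h =>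
      hinj (mem_filter.1 hM).1 (mem_filter.1 hM').1 h]
  refine ⟨𝓕', fun M hM => (mem_filter.1 (mem_filter.1 hM).1).1, ?_, ?_⟩
  · rw [h𝓕'card]; exact h𝒱'two
  -- Step 5: the flip coupling and the pointwise Claim 1
  set K := SetFamily.core (𝓕'.image everts) with hK
  have hKV : SetFamily.core 𝒱' = K := by rw [hK, himg]
  set φ : Finset (Vtx m) → Finset (Vtx m) := fun W =>
    (univ \ K).filter fun v => crossTarget b 𝓕' W v = false with hφdef
  have hRN : Disjoint K (univ \ K) := disjoint_sdiff
  have hφN : ∀ W, φ W ⊆ univ \ K := fun W => filter_subset _ _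
  have hsoloK : soloCore b 𝓕' ⊆ K := filter_subset _ _
  have hφR : ∀ W, φ W = φ (W ∩ K) := fun W => by
    simp only [hφdef]
    refine filter_congr fun v _ => ?_
    rw [crossTarget_inter hsoloK]
  have hE : ∀ x ∈ univ \ K, ∀ W : Finset (Vtx m),
      (∃ V ∈ 𝒱', V ⊆ W ∪ SetFamily.core 𝒱') → ∃ V ∈ 𝒱', V ⊆ insert x W ∪ SetFamily.core 𝒱' := by
    rintro x - W ⟨V, hV, hVW⟩
    exact ⟨V, hV, hVW.trans (union_subset_union (subset_insert x W) le_rfl)⟩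
  have hflip := BiasedFlip.sum_biasedWeight_filter_le_symmDiff hp0.le hp1 K (univ \ K) hRN φ hφN hφR
    (fun W => ∃ V ∈ 𝒱', V ⊆ W ∪ SetFamily.core 𝒱') hE
  -- pointwise: after the flip, the robustness event implies the cross-sunflower event
  have hpt : (univ.filter fun W : Finset (Vtx m) =>
      ∃ V ∈ 𝒱', V ⊆ symmDiff W (φ W) ∪ SetFamily.core 𝒱') ⊆
      univ.filter fun W : Finset (Vtx m) => ∃ M ∈ 𝓕', M \ core 𝓕' ⊆ crossGraph W := by
    intro W hW
    obtain ⟨V, hV, hVW⟩ := (mem_filter.1 hW).2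
    rw [← himg] at hV
    obtain ⟨M, hM, rfl⟩ := mem_image.1 hV
    refine mem_filter.2 ⟨mem_univ _, M, hM, cross_of_crossTarget h𝓕'b hM fun v hv hvK => ?_⟩
    have hv' := hVW hv
    rw [mem_union, hKV] at hv'
    rcases hv' with h | h
    · rw [mem_symmDiff] at h
      have hvφ : v ∈ φ W ↔ crossTarget b 𝓕' W v = false := by
        simp only [hφdef, mem_filter, mem_sdiff, mem_univ, true_and]
        exact ⟨fun h => h.2, fun h => ⟨hvK, h⟩⟩
      rcases h with ⟨hvW, hvn⟩ | ⟨hvp, hvW⟩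
      · rw [hvφ] at hvn
        rw [decide_eq_true hvW]
        cases htg : crossTarget b 𝓕' W v
        · exact absurd htg hvn
        · rfl
      · rw [hvφ] at hvp
        rw [decide_eq_false hvW, hvp]
    · exact absurd h hvK
  calc 1 - ε < _ := hrob
    _ ≤ _ := hflip
    _ ≤ _ := sum_le_sum_of_subset_of_nonneg hpt fun W _ _ =>
        SetFamily.biasedWeight_nonneg hp0.le (by linarith) W

/-- **Registered stub `stub_biasedMatchingSunflower` of line `r7-crosscut`** (item
stmt-PneNP-19861, skeleton sha 0079776e761d5a21): R7-B by name, from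
`biasedMatchingSunflower_holds`. -/
theorem stub_biasedMatchingSunflower : BiasedMatchingSunflower :=
  biasedMatchingSunflower_holds

end Summit.PneNP.PneNP.Theorems.NegLimitedGapPM
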